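import Summits.MatrixMultiplication.MatrixMultiplication.Theses.ThinBlockAlpha

/-!
# Candidate proof of STUB 2 `stub_rigidClassUSP` of line `tame-charts` (refuter drefute seat; evidence for the lead)

Definitions are VERBATIM copies of `Cruxes/BoundedExponentThird/Lines/tame-charts.lean` (not an importable module), so the
proof of `rigidClassUSP_proof` below transplants textually into the skeleton (replace the `sorry` of `stub_rigidClassUSP`).
-/

set_option linter.dupNamespace false

namespace Summit.MatrixMultiplication.MatrixMultiplication.Cruxes.BoundedExponentThird.TameChartsStub2

open Finset

/-- verbatim copy of `TameCharts.Bad`. -/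
def Bad {Z : Type} [AddCommGroup Z] {k : ℕ} (SA SB SC : Fin k → Finset Z) (x y z : Fin k) : Prop :=
  ∃ s' ∈ SA x, ∃ s ∈ SA z, ∃ t' ∈ SB y, ∃ t ∈ SB x, ∃ u' ∈ SC z, ∃ u ∈ SC y,
    (s' - s) + (t' - t) + (u' - u) = 0

/-- verbatim copy of `TameCharts.IsLocalChartUSP`. -/
def IsLocalChartUSP {Z : Type} [AddCommGroup Z] {k : ℕ} (SA SB SC : Fin k → Finset Z) {n L : ℕ}
    (row : Fin L → Fin n → Fin k) : Prop :=
  ∀ i j l : Fin L, ¬ (i = j ∧ j = l) → ∃ c : Fin n, ¬ Bad SA SB SC (row i c) (row j c) (row l c)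

/-- verbatim copy of `TameCharts.IsRigid`. -/
def IsRigid {Z : Type} [AddCommGroup Z] {k : ℕ} (SA SB SC : Fin k → Finset Z) : Prop :=
  ∃ φ₁ φ₂ φ₃ : Fin k → ℤ, (∀ x, φ₁ x + φ₂ x + φ₃ x = 0) ∧
    ∀ x y z : Fin k, Bad SA SB SC x y z → ¬ (x = y ∧ y = z) → 0 < φ₁ x + φ₂ y + φ₃ z

/-- verbatim copy of `TameCharts.HasType`. -/
def HasType {k n : ℕ} (w : Fin n → Fin k) (μ : Fin k → ℕ) : Prop :=
  ∀ x, (univ.filter fun c => w c = x).card = μ x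

/-- Summing a symbol potential over the coordinates of a word of type `μ`. -/
theorem sum_coord_eq_sum_type {k n : ℕ} {w : Fin n → Fin k} {μ : Fin k → ℕ} (hw : HasType w μ)
    (φ : Fin k → ℤ) : ∑ c, φ (w c) = ∑ x, (μ x : ℤ) * φ x := by
  rw [← Finset.sum_fiberwise (s := (univ : Finset (Fin n))) (g := w) (f := fun c => φ (w c))]
  refine Finset.sum_congr rfl fun x _ => ?_
  have h1 : ∑ c ∈ univ.filter (fun c => w c = x), φ (w c) = ∑ c ∈ univ.filter (fun c => w c = x), φ x :=
    Finset.sum_congr rfl fun c hc => by rw [(Finset.mem_filter.mp hc).2]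
  rw [h1, Finset.sum_const, hw x, nsmul_eq_mul]

/-- **STUB 2** (`RigidClassUSP` verbatim): Gordan potentials make every injective constant-type row family a local chart-USP. -/
theorem rigidClassUSP_proof :
    ∀ (Z : Type) [AddCommGroup Z] (k : ℕ) (SA SB SC : Fin k → Finset Z), IsRigid SA SB SC →
      ∀ (n L : ℕ) (μ : Fin k → ℕ) (row : Fin L → Fin n → Fin k), Function.Injective row →
        (∀ i, HasType (row i) μ) → IsLocalChartUSP SA SB SC row := by
  intro Z _ k SA SB SC hR n L μ row hinj htyp i j l hne
  obtain ⟨φ₁, φ₂, φ₃, hsum, hpos⟩ := hR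
  by_contra hall
  push Not at hall
  -- the potential of the triple summed over coordinates vanishes
  have htot : ∑ c, (φ₁ (row i c) + φ₂ (row j c) + φ₃ (row l c)) = 0 := by
    rw [Finset.sum_add_distrib, Finset.sum_add_distrib, sum_coord_eq_sum_type (htyp i),
      sum_coord_eq_sum_type (htyp j), sum_coord_eq_sum_type (htyp l), ← Finset.sum_add_distrib,
      ← Finset.sum_add_distrib]
    refine Finset.sum_eq_zero fun x _ => ?_
    rw [← mul_add, ← mul_add, hsum x, mul_zero]
  -- each coordinate contributes a nonnegative amount, positive off the diagonal
  have hnn : ∀ c, 0 ≤ φ₁ (row i c) + φ₂ (row j c) + φ₃ (row l c) := by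
    intro c
    by_cases hd : row i c = row j c ∧ row j c = row l c
    · rw [hd.1, hd.2, hsum]
    · exact le_of_lt (hpos _ _ _ (hall c) hd)
  have hzero : ∀ c, φ₁ (row i c) + φ₂ (row j c) + φ₃ (row l c) = 0 := fun c =>
    (Finset.sum_eq_zero_iff_of_nonneg (fun c _ => hnn c)).mp htot c (Finset.mem_univ c)
  have hdiag : ∀ c, row i c = row j c ∧ row j c = row l c := by
    intro c
    by_contra hd
    have := hpos _ _ _ (hall c) hd
    linarith [hzero c]
  have hij : row i = row j := funext fun c => (hdiag c).1
  have hjl : row j = row l := funext fun c => (hdiag c).2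
  exact hne ⟨hinj hij, hinj hjl⟩

end Summit.MatrixMultiplication.MatrixMultiplication.Cruxes.BoundedExponentThird.TameChartsStub2
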